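import Literature.Computability.Cryptography.QuantumTuringMachineCircuitLayout
import HarnessLib

/-!
# The simulating circuit family computes the machine's acceptance probability exactly (Nishimura–Ozawa 2002, Thm. 4.3, for the tree's model)

Fifth file of the head-centred simulation of quantum Turing machines. For the circuit family
`hcFamily M p` of `QuantumTuringMachineCircuitLayout.lean` (gate set `𝒢_M`, layout `θ`, code `ι`) we
prove the semantics: **`acceptProbOn_hcFamily`** — for every machine `M` well formed in the tree's sense,
every polynomial `p` and input `x`, the family's acceptance probability on `x` (the tree's
`QCircuitFamily.acceptProbOn`: run `|x⟩|0…0⟩`, measure wire `0`) equals `QTM.acceptProbAt M x (p |x|)`.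

The proof follows the three stages of the circuit:
* **load** (`loadGates_mulVec_single`, `padInput_eq_ι`, `rLoad_univ_eq_encCfg`): `|x⟩|0…0⟩` is the code of the
  register `(q₀, blank window, L, 0)` (start state and blank are coded by zeros) and the load gates turn it into
  the code of `(q₀, window of tape[x], L, 0) = encCfg (init x)`;
* **steps** (`stepGates_mulVec_pushVec`): by the bridge lemma of `…CodedGates.lean` (the pins of `W`, `E` carry
  exactly the local components, `hcompatW`, `hcompatE`) and the basis action of the controlled swaps
  (`gCS_mulVec_single`, the words `csGatesR/L` realising the controlled cyclic shift, `uS_eq_prod` of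
  `…HeadCentredGates.lean`), one `stepGates` block acts on coded registers as `hcUnitary M N`
  (`hcUnitary_eq_factor`), hence `p(n)` blocks as its `p(n)`-th power;
* **readout** (`finalGates_mulVec_single`, `finMap_zero`): the answer `[state = accept]` ends on wire `0`,
  injectively in the register state, so the Born probability of wire `0` is the Born probability of
  {state = accept} (`sum_pushVec`), which is `acceptProbAt` by `QTM.acceptProbAt_eq_hcUnitary`
  (`…HeadCentred.lean`, window size `N = 2(n + p(n)) + 3`).

Everything is proved; no named facts. What remains for `BQPQTM ⊆ BQP` is the uniformity of `hcFamily` and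
gate-set independence (`BQPOver_eq_BQP`).

## References

* H. Nishimura, M. Ozawa, Theoret. Comput. Sci. 276 (2002) 147–181 = arXiv:quant-ph/9906095
  [NishimuraOzawa2002], §4 (circuits, `t`-simulation, `e_t`, `u(x, K)`), Thm. 4.3 and its proof.
* A. C.-C. Yao, *Quantum circuit complexity*, FOCS 1993 [Yao1993].
-/

noncomputable section

namespace Literature.Computability.Cryptography

open Turing Matrix
open scoped BigOperators

namespace QTM

/-! ### Generic facts: basis actions of classical placed gates, words, pushed vectors -/

section generic

variable {k W : ℕ}

/-- A bit string is determined by its values on the wires of a placement and off them. [folklore] -/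
theorem qreg_eq_of_on_off (e : Fin k ↪ Fin W) {y z : QReg W} (hon : z ∘ e = y ∘ e)
    (hoff : ∀ i, i ∉ Set.range e → z i = y i) : z = y := by
  funext i
  by_cases hi : i ∈ Set.range e
  · obtain ⟨c, rfl⟩ := hi
    exact congrFun hon c
  · exact hoff i hi

/-- Equality of bit strings, split along the wires of a placement. [folklore] -/
theorem qreg_eq_iff_on_off (e : Fin k ↪ Fin W) (y z : QReg W) :
    z = y ↔ z ∘ e = y ∘ e ∧ ∀ i, i ∉ Set.range e → z i = y i :=
  ⟨fun h => by subst h; exact ⟨rfl, fun _ _ => rfl⟩, fun h => qreg_eq_of_on_off e h.1 h.2⟩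

/-- The column of a placed gate at a basis vector (unfolding `placeGate`). [folklore] -/
theorem placeGate_mulVec_single_apply (e : Fin k ↪ Fin W) (U : Matrix (QReg k) (QReg k) ℂ)
    (y z : QReg W) : (placeGate e U *ᵥ Pi.single y 1) z =
      if (∀ i, i ∉ Set.range e → z i = y i) then U (z ∘ e) (y ∘ e) else 0 := by
  rw [mulVec_single_one, col_apply, placeGate_apply]

variable {A : Type} [Fintype A] [DecidableEq A]

/-- **Basis action of a placed classical (permutation) gate on a coded alphabet**: if the gate wires of `y`
carry the code of `a`, then the placed extended permutation gate sends `|y⟩` to `|y'⟩`, where `y'` carries the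
code of `f a` on the gate wires and agrees with `y` elsewhere (Nishimura–Ozawa 2002, proof of Thm. 4.3:
the "reversible Boolean gate" `G₂`). [cite: NishimuraOzawa2002, Thm. 4.3 (proof, gate G₂)] -/
theorem placeGate_extendGate_permMat_single (e : Fin k ↪ Fin W) {κ : A → QReg k}
    (hκ : Function.Injective κ) (f : Equiv.Perm A) (y y' : QReg W) (a : A) (hy : y ∘ e = κ a)
    (hy' : y' ∘ e = κ (f a)) (hoff : ∀ i, i ∉ Set.range e → y' i = y i) :
    placeGate e (extendGate κ (permMat f)) *ᵥ Pi.single y 1 = Pi.single y' 1 := by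
  ext z
  rw [placeGate_mulVec_single_apply, Pi.single_apply, hy]
  by_cases hz : ∀ i, i ∉ Set.range e → z i = y i
  · rw [if_pos hz]
    by_cases hze : z ∘ e ∈ Set.range κ
    · obtain ⟨a'', ha''⟩ := hze
      have key : (f a = a'') ↔ (z = y') := by
        rw [qreg_eq_iff_on_off e y' z, hy', ← ha'', hκ.eq_iff]
        exact ⟨fun h => ⟨h.symm, fun i hi => (hz i hi).trans (hoff i hi).symm⟩, fun h => h.1.symm⟩
      rw [← ha'', extendGate_code_code hκ, permMat_apply]
      simp only [key]
    · rw [extendGate_of_not_mem_code _ hze, if_neg]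
      rintro rfl
      exact hze ⟨f a, hy'.symm⟩
  · rw [if_neg hz, if_neg]
    rintro rfl
    exact hz fun i hi => hoff i hi

/-- Basis action of a placed two-qubit swap: `|y⟩ ↦ |y ∘ (e 0 ↔ e 1)⟩`. [folklore] -/
theorem placeGate_swapPerm_single (e : Fin 2 ↪ Fin W) (y : QReg W) :
    placeGate e (permMat swapPerm) *ᵥ Pi.single y 1 = Pi.single (y ∘ Equiv.swap (e 0) (e 1)) 1 := by
  ext z
  rw [placeGate_mulVec_single_apply, Pi.single_apply, permMat_apply]
  have hsw : ∀ w : QReg W, (w ∘ Equiv.swap (e 0) (e 1)) ∘ e = swapPerm (w ∘ e) := by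
    intro w
    funext c
    show w (Equiv.swap (e 0) (e 1) (e c)) = w (e (Equiv.swap 0 1 c))
    fin_cases c
    · simp [Equiv.swap_apply_left]
    · simp [Equiv.swap_apply_right]
  have hoff : ∀ i, i ∉ Set.range e → (y ∘ Equiv.swap (e 0) (e 1)) i = y i := by
    intro i hi
    show y (Equiv.swap (e 0) (e 1) i) = y i
    rw [Equiv.swap_apply_of_ne_of_ne]
    · rintro rfl; exact hi ⟨0, rfl⟩
    · rintro rfl; exact hi ⟨1, rfl⟩
  by_cases hz : ∀ i, i ∉ Set.range e → z i = y i
  · rw [if_pos hz]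
    have : (swapPerm (y ∘ e) = z ∘ e) ↔ (z = y ∘ Equiv.swap (e 0) (e 1)) := by
      rw [qreg_eq_iff_on_off e, hsw]
      exact ⟨fun h => ⟨h.symm, fun i hi => (hz i hi).trans (hoff i hi).symm⟩, fun h => h.1.symm⟩
    simp only [this]
  · rw [if_neg hz, if_neg]
    rintro rfl
    exact hz hoff

variable {X : Type*} [Fintype X]

/-- A pushed vector as a combination of code basis vectors: `pushVec ι v = ∑_r v r |ι r⟩`. [folklore] -/
theorem pushVec_eq_sum [DecidableEq X] (ι : X → QReg W) (v : X → ℂ) :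
    pushVec ι v = ∑ r, v r • (Pi.single (ι r) (1 : ℂ) : QReg W → ℂ) := by
  ext y
  simp only [pushVec_apply, Finset.sum_apply, Pi.smul_apply, Pi.single_apply, smul_eq_mul, mul_ite,
    mul_one, mul_zero]
  refine Finset.sum_congr rfl fun r _ => ?_
  rcases eq_or_ne (ι r) y with h | h
  · simp [h]
  · simp [h, Ne.symm h]

/-- An operator permuting the code basis vectors by `σ` acts on pushed vectors as the permutation matrix of
`σ`. [folklore] -/
theorem mulVec_pushVec_of_perm [DecidableEq X] {G : Matrix (QReg W) (QReg W) ℂ} {ι : X → QReg W}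
    (σ : Equiv.Perm X) (hG : ∀ r, G *ᵥ Pi.single (ι r) 1 = Pi.single (ι (σ r)) 1) (v : X → ℂ) :
    G *ᵥ pushVec ι v = pushVec ι (permMat σ *ᵥ v) := by
  rw [pushVec_eq_sum, pushVec_eq_sum, mulVec_sum]
  simp only [mulVec_smul, hG, permMat_mulVec]
  conv_rhs => rw [← Equiv.sum_comp σ]
  simp only [Equiv.symm_apply_apply]

/-- An operator sending code basis vectors to basis vectors `|g r⟩` re-codes pushed vectors along `g`. [folklore] -/
theorem mulVec_pushVec_of_single [DecidableEq X] {G : Matrix (QReg W) (QReg W) ℂ} {ι g : X → QReg W}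
    (hG : ∀ r, G *ᵥ Pi.single (ι r) 1 = Pi.single (g r) 1) (v : X → ℂ) :
    G *ᵥ pushVec ι v = pushVec g v := by
  rw [pushVec_eq_sum, pushVec_eq_sum, mulVec_sum]
  simp only [mulVec_smul, hG]

/-- The operator of a gate list (head applied first; `QCircuit.toMatrix` of the circuit with these gates,
`toMatrix_eq_listMat`) — Nishimura–Ozawa's `G(K) = U_m ⋯ U_1`. [cite: NishimuraOzawa2002, §4] -/
def listMat {G : QGateSet} (gs : List (QGate G W)) : Matrix (QReg W) (QReg W) ℂ :=
  (gs.map (QGate.toMatrix (0 : Language Bool))).reverse.prod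

/-- The empty gate list is the identity. [folklore] -/
theorem listMat_nil {G : QGateSet} : listMat ([] : List (QGate G W)) = 1 := by simp [listMat]

/-- Prepending a gate: it acts first. [folklore] -/
theorem listMat_cons {G : QGateSet} (g : QGate G W) (gs : List (QGate G W)) :
    listMat (g :: gs) = listMat gs * g.toMatrix 0 := by
  simp [listMat]

/-- Concatenation of gate lists multiplies the operators in reverse order (`K₂ ∘ K₁`, §4). [cite: NishimuraOzawa2002, §4] -/
theorem listMat_append {G : QGateSet} (gs gs' : List (QGate G W)) :
    listMat (gs ++ gs') = listMat gs' * listMat gs := by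
  simp [listMat, List.prod_append]

/-- A one-gate list is the gate. [folklore] -/
theorem listMat_singleton {G : QGateSet} (g : QGate G W) : listMat [g] = g.toMatrix 0 := by
  simp [listMat]

/-- Repeating a gate list `T` times is the `T`-th power (`K^n`, the concatenation of `n` copies, §4). [cite: NishimuraOzawa2002, §4] -/
theorem listMat_flatten_replicate {G : QGateSet} (gs : List (QGate G W)) (T : ℕ) :
    listMat (List.replicate T gs).flatten = (listMat gs) ^ T := by
  induction T with
  | zero => simp [listMat_nil]
  | succ T ih => rw [List.replicate_succ, List.flatten_cons, listMat_append, ih, ← pow_succ]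

/-- `QCircuit.toMatrix` is `listMat` of the gate list (definitional). [folklore] -/
theorem toMatrix_eq_listMat {G : QGateSet} (C : QCircuit G W) : C.toMatrix 0 = listMat C.gates := rfl

/-- A word of gates permuting the code basis vectors acts on pushed vectors as the permutation matrix of the
composite permutation. [folklore] -/
theorem listMat_mulVec_pushVec_of_forall₂ [DecidableEq X] {G : QGateSet} {ι : X → QReg W}
    {gs : List (QGate G W)} {σs : List (Equiv.Perm X)}
    (h : List.Forall₂ (fun g σ => ∀ r, g.toMatrix 0 *ᵥ Pi.single (ι r) 1 = Pi.single (ι (σ r)) 1) gs σs)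
    (v : X → ℂ) : listMat gs *ᵥ pushVec ι v = pushVec ι (permMat σs.reverse.prod *ᵥ v) := by
  induction h generalizing v with
  | nil => simp [listMat_nil, permMat_one]
  | @cons g σ gs σs hg _ ih =>
    rw [listMat_cons, ← mulVec_mulVec, mulVec_pushVec_of_perm σ hg, ih, mulVec_mulVec, ← permMat_mul,
      List.reverse_cons, List.prod_append, List.prod_singleton]

/-- Powers of an operator that is simulated on pushed vectors are simulated by the powers. [folklore] -/
theorem pow_mulVec_pushVec [DecidableEq X] {ι : X → QReg W} {G : Matrix (QReg W) (QReg W) ℂ} {X' : Matrix X X ℂ}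
    (h : ∀ v, G *ᵥ pushVec ι v = pushVec ι (X' *ᵥ v)) (T : ℕ) (v : X → ℂ) :
    G ^ T *ᵥ pushVec ι v = pushVec ι (X' ^ T *ᵥ v) := by
  induction T generalizing v with
  | zero => simp
  | succ T ih => rw [pow_succ, ← mulVec_mulVec, h, ih, mulVec_mulVec, ← pow_succ]

end generic

/-! ### Layout facts -/

section layoutfacts

variable (M : QTM) (p : Polynomial ℕ) (n : ℕ)

variable {M p n}

/-- A wire is a pin of a structured placement iff its structured index is. [folklore] -/
theorem mem_range_embOf {kk : ℕ} {B : Type} (θ' : B ≃ Fin kk) (f : B → M.Idx p n)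
    (hf : Function.Injective f) (z : M.Idx p n) :
    M.θ p n z ∈ Set.range (M.embOf p n θ' f hf) ↔ z ∈ Set.range f := by
  constructor
  · rintro ⟨c, hc⟩
    exact ⟨θ'.symm c, (M.θ p n).injective hc⟩
  · rintro ⟨b, rfl⟩
    exact ⟨θ' b, embOf_apply _ _ _ _ _ _ _⟩

/-- Quantifying over the wires off a structured placement, in structured indices. [folklore] -/
theorem forall_off_iff {kk : ℕ} {B : Type} (θ' : B ≃ Fin kk) (f : B → M.Idx p n)
    (hf : Function.Injective f) (P : Fin (n + M.anc p n) → Prop) :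
    (∀ i, i ∉ Set.range (M.embOf p n θ' f hf) → P i) ↔ ∀ z, z ∉ Set.range f → P (M.θ p n z) := by
  constructor
  · intro h z hz
    exact h _ (mt (mem_range_embOf θ' f hf z).1 hz)
  · intro h i hi
    obtain ⟨z, rfl⟩ := (M.θ p n).surjective i
    exact h z (mt (mem_range_embOf θ' f hf z).2 hi)

/-- Block `0` is window position `0` (the scanned cell). [folklore] -/
theorem cellOf_cell0 : cellOf p n (cell0 p n) = 0 := by
  simp [cellOf, cell0]

/-- Block `j` is window position `j mod N` (definitional). [folklore] -/
theorem cellOf_cellAt (j : ℕ) (hj : j < nw p n) : cellOf p n (cellAt p n j hj) = (j : ZMod (nw p n)) := rfl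

/-- The window position of block `j` has value `j`. [folklore] -/
theorem val_cellOf (j : Fin (nw p n)) : (cellOf p n j).val = j.val := by
  rw [cellOf, ZMod.val_natCast, Nat.mod_eq_of_lt j.2]

/-- Blocks other than `0` are window positions other than `0`. [folklore] -/
theorem cellOf_ne_zero {j : Fin (nw p n)} (hj : j ≠ cell0 p n) : cellOf p n j ≠ 0 := by
  intro h
  apply hj
  apply cellOf_injective p n
  rw [h, cellOf_cell0]

end layoutfacts


/-! ### Reading the code on and off the wires of each gate -/

section structured

variable (M : QTM) (p : Polynomial ℕ) (n : ℕ) (x : Fin n → Bool)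

/-- **The pins of `W` carry the local code** `(q, w 0, d, e)` of the register. [cite: NishimuraOzawa2002, Thm. 4.3 (proof)] -/
theorem ι_comp_eW (a : Bool) (r : M.HC (nw p n)) :
    (M.ι p n x a r) ∘ (M.eW p n) = M.κLoc (r.1, r.2.1 0, r.2.2.1, r.2.2.2) := by
  funext c
  obtain ⟨l, rfl⟩ := M.θLoc.surjective c
  rw [Function.comp_apply, eW, embOf_apply, ι_apply_θ, κLoc, Function.comp_apply, Equiv.symm_apply_apply]
  rcases l with (((b | b) | d) | e)
  · rfl
  · show M.κΓ (r.2.1 (cellOf p n (cell0 p n))) b = M.κΓ (r.2.1 0) b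
    rw [cellOf_cell0]
  · rfl
  · rfl

/-- The pins of `E` carry the erasure code `(q, d, e)`. [folklore] -/
theorem ι_comp_eE (a : Bool) (r : M.HC (nw p n)) :
    (M.ι p n x a r) ∘ (M.eE p n) = M.κEr (r.1, r.2.2.1, r.2.2.2) := by
  funext c
  obtain ⟨l, rfl⟩ := M.θEr.surjective c
  rw [Function.comp_apply, eE, embOf_apply, ι_apply_θ, κEr, Function.comp_apply, Equiv.symm_apply_apply]
  rcases l with ((b | d) | e) <;> rfl

/-- The pins of the controlled swap of blocks `j₁`, `j₂` carry `(d, w j₁, w j₂)`. [folklore] -/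
theorem ι_comp_eCS (a : Bool) (r : M.HC (nw p n)) (j₁ j₂ : ℕ) (h₁ : j₁ < nw p n) (h₂ : j₂ < nw p n)
    (hne : j₁ ≠ j₂) :
    (M.ι p n x a r) ∘ (M.eCS p n j₁ j₂ h₁ h₂ hne) =
      M.κCS (r.2.2.1, r.2.1 (j₁ : ZMod (nw p n)), r.2.1 (j₂ : ZMod (nw p n))) := by
  funext c
  obtain ⟨l, rfl⟩ := M.θCS.surjective c
  rw [Function.comp_apply, eCS, embOf_apply, ι_apply_θ, κCS, Function.comp_apply, Equiv.symm_apply_apply]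
  rcases l with ((d | b) | b) <;> rfl

/-- The pins of the load gate `i` carry `(x i, w i)`. [folklore] -/
theorem ι_comp_eLD (a : Bool) (r : M.HC (nw p n)) (i : Fin n) :
    (M.ι p n x a r) ∘ (M.eLD p n i) = M.κLD (x i, r.2.1 (i.val : ZMod (nw p n))) := by
  funext c
  obtain ⟨l, rfl⟩ := M.θLD.surjective c
  rw [Function.comp_apply, eLD, embOf_apply, ι_apply_θ, κLD, Function.comp_apply, Equiv.symm_apply_apply]
  rcases l with (d | b) <;> rfl

/-- The pins of the readout gate carry `(q, a)`. [folklore] -/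
theorem ι_comp_eAC (a : Bool) (r : M.HC (nw p n)) :
    (M.ι p n x a r) ∘ (M.eAC p n) = M.κAC (r.1, a) := by
  funext c
  obtain ⟨l, rfl⟩ := M.θAC.surjective c
  rw [Function.comp_apply, eAC, embOf_apply, ι_apply_θ, κAC, Function.comp_apply, Equiv.symm_apply_apply]
  rcases l with (b | d) <;> rfl

/-- Registers with the same window off cell `0` have the same code off the pins of `W`. [folklore] -/
theorem ι_agree_off_eW (a : Bool) {r r' : M.HC (nw p n)}
    (hw : ∀ j : ZMod (nw p n), j ≠ 0 → r.2.1 j = r'.2.1 j) :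
    ∀ i, i ∉ Set.range (M.eW p n) → M.ι p n x a r i = M.ι p n x a r' i := by
  rw [eW, forall_off_iff]
  intro z hz
  rw [ι_apply_θ, ι_apply_θ]
  rcases idx_cases z with ⟨i, rfl⟩ | rfl | ⟨b, rfl⟩ | rfl | rfl | ⟨j, b, rfl⟩
  · rfl
  · rfl
  · exact absurd ⟨Sum.inl (Sum.inl (Sum.inl b)), rfl⟩ hz
  · exact absurd ⟨Sum.inl (Sum.inr 0), rfl⟩ hz
  · exact absurd ⟨Sum.inr 0, rfl⟩ hz
  · by_cases hj : j = cell0 p n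
    · subst hj
      exact absurd ⟨Sum.inl (Sum.inl (Sum.inr b)), rfl⟩ hz
    · simp only [idxVal_ixCell]
      rw [hw _ (cellOf_ne_zero hj)]

/-- Cells other than `0` are off the pins of `W`. [folklore] -/
theorem ixCell_not_mem_range_locWires {j : Fin (nw p n)} (hj : j ≠ cell0 p n) (b : Fin M.kΓ) :
    (ixCell j b : M.Idx p n) ∉ Set.range (M.locWires p n) := by
  rintro ⟨l, hl⟩
  rcases l with (((b' | b') | d) | e)
  · simp [locWires, ixSt, ixCell] at hl
  · simp only [locWires, Sum.elim_inl, Sum.elim_inr, ixCell, Sum.inr.injEq, Prod.mk.injEq] at hl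
    exact hj hl.1.symm
  · simp [locWires, ixD, ixCell] at hl
  · simp [locWires, ixE, ixCell] at hl

/-- Conversely, codes agreeing off the pins of `W` have the same window off cell `0`. [folklore] -/
theorem w_agree_of_ι_agree_off_eW (a : Bool) {r r' : M.HC (nw p n)}
    (h : ∀ i, i ∉ Set.range (M.eW p n) → M.ι p n x a r i = M.ι p n x a r' i) :
    ∀ j : ZMod (nw p n), j ≠ 0 → r.2.1 j = r'.2.1 j := by
  rw [eW, forall_off_iff] at h
  intro j hj
  obtain ⟨jf, rfl⟩ := cellOf_surjective p n j
  have hjf : jf ≠ cell0 p n := fun h' => hj (by rw [h', cellOf_cell0])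
  apply M.κΓ_injective
  funext b
  have := h (ixCell jf b) (M.ixCell_not_mem_range_locWires p n hjf b)
  simpa using this

/-- Registers with the same window have the same code off the pins of `E`. [folklore] -/
theorem ι_agree_off_eE (a : Bool) {r r' : M.HC (nw p n)} (hw : r.2.1 = r'.2.1) :
    ∀ i, i ∉ Set.range (M.eE p n) → M.ι p n x a r i = M.ι p n x a r' i := by
  rw [eE, forall_off_iff]
  intro z hz
  rw [ι_apply_θ, ι_apply_θ]
  rcases idx_cases z with ⟨i, rfl⟩ | rfl | ⟨b, rfl⟩ | rfl | rfl | ⟨j, b, rfl⟩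
  · rfl
  · rfl
  · exact absurd ⟨Sum.inl (Sum.inl b), rfl⟩ hz
  · exact absurd ⟨Sum.inl (Sum.inr 0), rfl⟩ hz
  · exact absurd ⟨Sum.inr 0, rfl⟩ hz
  · simp [hw]

/-- All cells are off the pins of `E`. [folklore] -/
theorem ixCell_not_mem_range_erWires (j : Fin (nw p n)) (b : Fin M.kΓ) :
    (ixCell j b : M.Idx p n) ∉ Set.range (M.erWires p n) := by
  rintro ⟨l, hl⟩
  rcases l with ((b' | d) | e)
  · simp [erWires, ixSt, ixCell] at hl
  · simp [erWires, ixD, ixCell] at hl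
  · simp [erWires, ixE, ixCell] at hl

/-- Codes agreeing off the pins of `E` have the same window. [folklore] -/
theorem w_eq_of_ι_agree_off_eE (a : Bool) {r r' : M.HC (nw p n)}
    (h : ∀ i, i ∉ Set.range (M.eE p n) → M.ι p n x a r i = M.ι p n x a r' i) : r.2.1 = r'.2.1 := by
  rw [eE, forall_off_iff] at h
  funext j
  obtain ⟨jf, rfl⟩ := cellOf_surjective p n j
  apply M.κΓ_injective
  funext b
  have := h (ixCell jf b) (M.ixCell_not_mem_range_erWires p n jf b)
  simpa using this

/-! ### The bridge data for the `W` and `E` gates -/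

/-- A reference local state (used to name the off-pin pattern of `W`). [folklore] -/
def locRest : M.Loc := (M.start, default, false, false)

/-- A reference erasure state (used to name the off-pin pattern of `E`). [folklore] -/
def erRest : M.Er := (M.start, false, false)

/-- Reassembling a head-centred register from its `W`-local part and the rest (definitional). [folklore] -/
theorem splitW_symm_apply (N : ℕ) (aL : M.Loc) (b : {i : ZMod N // i ≠ 0} → M.Γ) :
    (M.splitW N).symm (aL, b) = (aL.1, fun i => if h : i = 0 then aL.2.1 else b ⟨i, h⟩, aL.2.2.1, aL.2.2.2) :=
  rfl

/-- Reassembling a head-centred register from its `E`-local part and the window (definitional). [folklore] -/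
theorem splitE_symm_apply (N : ℕ) (aE : M.Er) (w : ZMod N → M.Γ) :
    (M.splitE N).symm (aE, w) = (aE.1, w, aE.2.1, aE.2.2) := rfl

/-- The off-pin pattern of `W` as a function of the window off cell `0` (the `B`-code of the bridge lemma). [folklore] -/
def lamW (a : Bool) (b : {i : ZMod (nw p n) // i ≠ 0} → M.Γ) :
    ((Set.range (M.eW p n))ᶜ : Set (Fin (n + M.anc p n))) → Bool :=
  (splitWires (M.eW p n) (M.ι p n x a ((M.splitW (nw p n)).symm (M.locRest, b)))).2

/-- The off-pin pattern of `E` as a function of the window. [folklore] -/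
def lamE (a : Bool) (w : ZMod (nw p n) → M.Γ) :
    ((Set.range (M.eE p n))ᶜ : Set (Fin (n + M.anc p n))) → Bool :=
  (splitWires (M.eE p n) (M.ι p n x a ((M.splitE (nw p n)).symm (M.erRest, w)))).2

/-- The off-pin pattern of `W` determines the window off cell `0`. [folklore] -/
theorem lamW_injective (a : Bool) : Function.Injective (M.lamW p n x a) := by
  intro b₁ b₂ h
  unfold lamW at h
  rw [splitWires_snd_eq_iff] at h
  have hw := M.w_agree_of_ι_agree_off_eW p n x a h
  funext ⟨i, hi⟩
  have := hw i hi
  simp only [splitW_symm_apply, hi, dif_neg, not_false_eq_true] at this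
  exact this

/-- The off-pin pattern of `E` determines the window. [folklore] -/
theorem lamE_injective (a : Bool) : Function.Injective (M.lamE p n x a) := by
  intro w₁ w₂ h
  unfold lamE at h
  rw [splitWires_snd_eq_iff] at h
  exact M.w_eq_of_ι_agree_off_eE p n x a h

/-- **The layout is compatible with the `W`-decomposition of the register**: the pins of `W` carry exactly the
local component and the other wires exactly the rest (hypothesis of the bridge lemma). [cite: NishimuraOzawa2002, Thm. 4.3 (proof)] -/
theorem hcompatW (a : Bool) (r : M.HC (nw p n)) :
    splitWires (M.eW p n) (M.ι p n x a r) =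
      (M.κLoc ((M.splitW (nw p n) r).1), M.lamW p n x a ((M.splitW (nw p n) r).2)) := by
  refine Prod.ext ?_ ?_
  · rw [splitWires_fst, ι_comp_eW]
    rfl
  · show (splitWires (M.eW p n) (M.ι p n x a r)).2 = _
    unfold lamW
    rw [splitWires_snd_eq_iff]
    apply M.ι_agree_off_eW p n x a
    intro j hj
    simp [splitW_symm_apply, hj]

/-- The layout is compatible with the `E`-decomposition of the register. [folklore] -/
theorem hcompatE (a : Bool) (r : M.HC (nw p n)) :
    splitWires (M.eE p n) (M.ι p n x a r) =
      (M.κEr ((M.splitE (nw p n) r).1), M.lamE p n x a ((M.splitE (nw p n) r).2)) := by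
  refine Prod.ext ?_ ?_
  · rw [splitWires_fst, ι_comp_eE]
    rfl
  · show (splitWires (M.eE p n) (M.ι p n x a r)).2 = _
    unfold lamE
    rw [splitWires_snd_eq_iff]
    exact M.ι_agree_off_eE p n x a rfl

/-- **The placed `W` gate acts on coded registers as the abstract local step gate** `wMat ⊗ 1`
(Nishimura–Ozawa: the `i`-th `G₁` transforms the encoded configuration as displayed in the proof of Thm. 4.3).
[cite: NishimuraOzawa2002, Thm. 4.3 (proof)] -/
theorem gW_mulVec_pushVec (a : Bool) (v : M.HC (nw p n) → ℂ) :
    (M.gW p n).toMatrix 0 *ᵥ pushVec (M.ι p n x a) v =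
      pushVec (M.ι p n x a) (liftMat (M.splitW (nw p n)) M.wMat *ᵥ v) := by
  change placeGate (M.eW p n) (extendGate M.κLoc M.wMat) *ᵥ _ = _
  exact placeGate_extendGate_mulVec_pushVec (M.splitW (nw p n)) (M.eW p n) M.κLoc_injective
    (M.lamW_injective p n x a) (M.hcompatW p n x a) M.wMat v

/-- The placed `E` gate acts on coded registers as the abstract erasure gate `eMat ⊗ 1`. [folklore] -/
theorem gE_mulVec_pushVec (a : Bool) (v : M.HC (nw p n) → ℂ) :
    (M.gE p n).toMatrix 0 *ᵥ pushVec (M.ι p n x a) v =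
      pushVec (M.ι p n x a) (liftMat (M.splitE (nw p n)) M.eMat *ᵥ v) := by
  change placeGate (M.eE p n) (extendGate M.κEr M.eMat) *ᵥ _ = _
  exact placeGate_extendGate_mulVec_pushVec (M.splitE (nw p n)) (M.eE p n) M.κEr_injective
    (M.lamE_injective p n x a) (M.hcompatE p n x a) M.eMat v

/-! ### The controlled swaps -/

/-- A placed controlled swap of blocks `j₁ ≠ j₂` acts on coded registers as the controlled window transposition
`winPerm b (j₁ j₂)`. [cite: NishimuraOzawa2002, Thm. 4.3 (proof, gate G₂)] -/
theorem gCS_mulVec_single (a : Bool) (b : Bool) (j₁ j₂ : ℕ) (h₁ : j₁ < nw p n) (h₂ : j₂ < nw p n)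
    (hne : j₁ ≠ j₂) (r : M.HC (nw p n)) :
    (M.gCS p n b j₁ j₂ h₁ h₂ hne).toMatrix 0 *ᵥ Pi.single (M.ι p n x a r) 1 =
      Pi.single (M.ι p n x a (M.winPerm (nw p n) b
        (Equiv.swap (j₁ : ZMod (nw p n)) (j₂ : ZMod (nw p n))) r)) 1 := by
  set σ := Equiv.swap (j₁ : ZMod (nw p n)) (j₂ : ZMod (nw p n)) with hσ
  set r' := M.winPerm (nw p n) b σ r with hr'
  have hr'd : r'.2.2.1 = r.2.2.1 := rfl
  have hr'w : r'.2.1 = if r.2.2.1 = b then r.2.1 ∘ σ else r.2.1 := rfl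
  change placeGate (M.eCS p n j₁ j₂ h₁ h₂ hne) (extendGate M.κCS (permMat (M.csPerm b))) *ᵥ _ = _
  apply placeGate_extendGate_permMat_single (M.eCS p n j₁ j₂ h₁ h₂ hne) M.κCS_injective (M.csPerm b) _ _
    (r.2.2.1, r.2.1 (j₁ : ZMod (nw p n)), r.2.1 (j₂ : ZMod (nw p n)))
  · exact M.ι_comp_eCS p n x a r j₁ j₂ h₁ h₂ hne
  · rw [ι_comp_eCS, csPerm_apply, hr'd, hr'w]
    by_cases hdb : r.2.2.1 = b
    · simp only [hdb, if_true, Function.comp_apply, hσ, Equiv.swap_apply_left, Equiv.swap_apply_right]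
    · simp only [hdb, if_false]
  · rw [eCS, forall_off_iff]
    intro z hz
    rw [ι_apply_θ, ι_apply_θ]
    rcases idx_cases z with ⟨i, rfl⟩ | rfl | ⟨b', rfl⟩ | rfl | rfl | ⟨j', b', rfl⟩
    · rfl
    · rfl
    · rfl
    · rfl
    · rfl
    · simp only [idxVal_ixCell, hr'w]
      by_cases hdb : r.2.2.1 = b
      · rw [if_pos hdb, Function.comp_apply, hσ]
        have e1 : j' ≠ cellAt p n j₁ h₁ := by
          rintro rfl; exact hz ⟨Sum.inl (Sum.inr b'), rfl⟩
        have e2 : j' ≠ cellAt p n j₂ h₂ := by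
          rintro rfl; exact hz ⟨Sum.inr b', rfl⟩
        rw [Equiv.swap_apply_of_ne_of_ne]
        · exact fun h => e1 (cellOf_injective p n h)
        · exact fun h => e2 (cellOf_injective p n h)
      · rw [if_neg hdb]

/-- The right word indexed by `Fin (N-1)`, with the transpositions written as swaps of blocks `j`, `j + 1`.
[folklore] -/
theorem rightWord_eq :
    M.rightWord (nw p n) = (List.finRange (nw p n - 1)).map fun j => M.winPerm (nw p n) true
      (Equiv.swap (j.val : ZMod (nw p n)) ((j.val + 1 : ℕ) : ZMod (nw p n))) := by
  rw [rightWord, ← List.map_coe_finRange_eq_range, List.map_map]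
  refine List.map_congr_left fun j _ => ?_
  simp only [Function.comp_apply, cellSwap, Nat.cast_succ]

/-- The right swap word acts on coded registers as the controlled shift `w ↦ w ∘ (· + 1)`. [folklore] -/
theorem csGatesR_mulVec_pushVec (a : Bool) (v : M.HC (nw p n) → ℂ) :
    listMat (M.csGatesR p n) *ᵥ pushVec (M.ι p n x a) v =
      pushVec (M.ι p n x a) (permMat ((M.rightWord (nw p n)).reverse.prod) *ᵥ v) := by
  apply listMat_mulVec_pushVec_of_forall₂
  rw [csGatesR, rightWord_eq, List.forall₂_map_left_iff, List.forall₂_map_right_iff, List.forall₂_same]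
  intro j _ r
  exact M.gCS_mulVec_single p n x a true j.val (j.val + 1) _ _ _ r

/-! ### The left move as a word of star transpositions -/

/-- The word `(0 1)(0 2)⋯(0 m+1)` of star transpositions of `ZMod N` (as a permutation; `(0 m+1)` applied first).
[folklore] -/
def prodStars (N m : ℕ) : Equiv.Perm (ZMod N) :=
  ((List.range (m + 1)).map fun j => Equiv.swap (0 : ZMod N) ((j + 1 : ℕ) : ZMod N)).prod

/-- `prodStars 0 = (0 1)`. [folklore] -/
theorem prodStars_zero (N : ℕ) : prodStars N 0 = Equiv.swap (0 : ZMod N) ((1 : ℕ) : ZMod N) := by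
  simp [prodStars]

/-- `prodStars (m+1) = prodStars m · (0 m+2)`. [folklore] -/
theorem prodStars_succ (N m : ℕ) :
    prodStars N (m + 1) = prodStars N m * Equiv.swap (0 : ZMod N) ((m + 2 : ℕ) : ZMod N) := by
  rw [prodStars, List.range_succ, List.map_append, List.prod_append, List.map_singleton,
    List.prod_singleton, prodStars]

/-- The star word is the inverse cycle `(0 ↦ m+1, k ↦ k-1 for 1 ≤ k ≤ m+1)`, fixing the rest (`m + 1 < N`).
[folklore] -/
theorem prodStars_spec {N : ℕ} [NeZero N] (m : ℕ) (hm : m + 1 < N) :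
    prodStars N m (0 : ZMod N) = ((m + 1 : ℕ) : ZMod N) ∧
      (∀ k : ℕ, 1 ≤ k → k ≤ m + 1 → prodStars N m (k : ZMod N) = ((k - 1 : ℕ) : ZMod N)) ∧
      (∀ z : ZMod N, (∀ i : ℕ, i ≤ m + 1 → z ≠ (i : ZMod N)) → prodStars N m z = z) := by
  have hne : ∀ {a b : ℕ}, a < N → b < N → a ≠ b → (a : ZMod N) ≠ (b : ZMod N) :=
    fun ha hb hab h => hab (natCast_zmod_inj ha hb h)
  induction m with
  | zero =>
    refine ⟨?_, fun k hk1 hk2 => ?_, fun z hz => ?_⟩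
    · rw [prodStars_zero, Equiv.swap_apply_left]
    · obtain rfl : k = 1 := by omega
      rw [prodStars_zero, Equiv.swap_apply_right]
      simp
    · rw [prodStars_zero, Equiv.swap_apply_of_ne_of_ne]
      · exact_mod_cast hz 0 (by omega)
      · exact hz 1 le_rfl
  | succ m ih =>
    obtain ⟨h1, h2, h3⟩ := ih (by omega)
    have hfix : ∀ z : ZMod N, z ≠ 0 → z ≠ ((m + 2 : ℕ) : ZMod N) →
        Equiv.swap (0 : ZMod N) ((m + 2 : ℕ) : ZMod N) z = z :=
      fun z hz0 hz2 => Equiv.swap_apply_of_ne_of_ne hz0 hz2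
    refine ⟨?_, fun k hk1 hk2 => ?_, fun z hz => ?_⟩
    · rw [prodStars_succ, Equiv.Perm.mul_apply, Equiv.swap_apply_left]
      rw [h3]
      intro i hi
      exact hne (by omega) (by omega) (by omega)
    · rw [prodStars_succ, Equiv.Perm.mul_apply]
      rcases Nat.lt_or_ge k (m + 2) with hlt | hge
      · rw [hfix]
        · exact h2 k hk1 (by omega)
        · exact_mod_cast hne (by omega) (NeZero.pos N) (by omega : k ≠ 0)
        · exact hne (by omega) (by omega) (by omega)
      · obtain rfl : k = m + 2 := by omega
        rw [Equiv.swap_apply_right, h1]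
        rfl
    · rw [prodStars_succ, Equiv.Perm.mul_apply, hfix z ?_ (hz (m + 2) le_rfl)]
      · exact h3 z fun i hi => hz i (by omega)
      · exact_mod_cast hz 0 (by omega)

/-- **The inverse cyclic shift is the increasing star word**: `(0 1)(0 2)⋯(0 N-1) = (z ↦ z - 1)` on `ZMod N`
(`N ≥ 2`). [folklore] -/
theorem prodStars_eq_sub_one {N : ℕ} [NeZero N] (hN : 2 ≤ N) (z : ZMod N) : prodStars N (N - 2) z = z - 1 := by
  obtain ⟨h1, h2, -⟩ := prodStars_spec (N := N) (N - 2) (by omega)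
  have hz : z = ((z.val : ℕ) : ZMod N) := (ZMod.natCast_zmod_val z).symm
  have hlt : z.val < N := ZMod.val_lt z
  rcases Nat.eq_zero_or_pos z.val with h0 | hpos
  · have hz0 : z = 0 := by rw [hz, h0, Nat.cast_zero]
    rw [hz0, h1, zero_sub]
    have : ((N - 2 + 1 : ℕ) : ZMod N) = ((N : ℕ) : ZMod N) - 1 := by
      rw [show N - 2 + 1 = N - 1 by omega, Nat.cast_sub (by omega), Nat.cast_one]
    rw [this, ZMod.natCast_self, zero_sub]
  · rw [hz, h2 z.val hpos (by omega), Nat.cast_sub hpos, Nat.cast_one]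

/-- The star word of controlled window transpositions for the left move. [folklore] -/
def starWord (N : ℕ) : List (Equiv.Perm (M.HC N)) :=
  (List.finRange (N - 1)).map fun j => M.winPerm N false (Equiv.swap (0 : ZMod N) ((j.val + 1 : ℕ) : ZMod N))

/-- The star word acts as the controlled shift `w ↦ w ∘ (· - 1)` (`N ≥ 2`). [folklore] -/
theorem starWord_reverse_prod {N : ℕ} [NeZero N] (hN : 2 ≤ N) :
    (M.starWord N).reverse.prod = M.winPerm N false (Equiv.addRight (-1 : ZMod N)) := by
  rw [starWord, show (List.finRange (N - 1)).map (fun j => M.winPerm N false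
      (Equiv.swap (0 : ZMod N) ((j.val + 1 : ℕ) : ZMod N))) =
    (((List.range (N - 2 + 1)).map fun j => Equiv.swap (0 : ZMod N) ((j + 1 : ℕ) : ZMod N)).map
      (M.winPerm N false)) by
      rw [List.map_map, show N - 2 + 1 = N - 1 by omega, ← List.map_coe_finRange_eq_range, List.map_map]
      rfl]
  rw [winPerm_reverse_prod, ← prodStars]
  congr 1
  ext z
  rw [prodStars_eq_sub_one hN]
  simp [sub_eq_add_neg]

/-- **The controlled cyclic shift is the composite of the star word (left) and the adjacent word (right).**
[cite: NishimuraOzawa2002, Thm. 4.3 (proof, gate G₂)] -/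
theorem shiftEquiv_eq_star_mul {N : ℕ} [NeZero N] (hN : 2 ≤ N) :
    M.shiftEquiv N = (M.starWord N).reverse.prod * (M.rightWord N).reverse.prod := by
  rw [starWord_reverse_prod M hN, rightWord_reverse_prod M N hN]
  ext1 r
  obtain ⟨q, w, d, e⟩ := r
  rw [shiftEquiv_apply, Equiv.Perm.mul_apply, winPerm_apply, winPerm_apply]
  cases d
  · simp only [Bool.false_eq_true, if_false, if_true, bshift, Prod.mk.injEq, true_and, and_true]
    funext i
    simp
  · simp only [if_true, Bool.true_eq_false, if_false, bshift, Prod.mk.injEq, true_and, and_true]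
    rfl

/-- The left (star) swap word acts on coded registers as the controlled shift `w ↦ w ∘ (· - 1)`. [folklore] -/
theorem csGatesL_mulVec_pushVec (a : Bool) (v : M.HC (nw p n) → ℂ) :
    listMat (M.csGatesL p n) *ᵥ pushVec (M.ι p n x a) v =
      pushVec (M.ι p n x a) (permMat ((M.starWord (nw p n)).reverse.prod) *ᵥ v) := by
  apply listMat_mulVec_pushVec_of_forall₂
  rw [csGatesL, starWord, List.forall₂_map_left_iff, List.forall₂_map_right_iff, List.forall₂_same]
  intro j _ r
  have := M.gCS_mulVec_single p n x a false 0 (j.val + 1) (Nat.pos_of_ne_zero (NeZero.ne _))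
    (by have := j.2; omega) (by omega) r
  simpa only [Nat.cast_zero] using this

/-- **One simulated step acts on coded registers as the head-centred step unitary `hcUnitary`**
(`= eMat·U_S·wMat`, `hcUnitary_eq_factor`): the head-centred `K₂ ∘ K₁` "carries out the operation corresponding
to one step of `M`" (Nishimura–Ozawa 2002, proof of Thm. 4.3). [cite: NishimuraOzawa2002, Thm. 4.3 (proof)] -/
theorem stepGates_mulVec_pushVec (v : M.HC (nw p n) → ℂ) :
    listMat (M.stepGates p n) *ᵥ pushVec (M.ι p n x false) v =
      pushVec (M.ι p n x false) (M.hcUnitary (nw p n) *ᵥ v) := by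
  rw [stepGates, listMat_append, listMat_append, listMat_append, listMat_singleton, listMat_singleton,
    ← mulVec_mulVec, ← mulVec_mulVec, ← mulVec_mulVec, gW_mulVec_pushVec, csGatesR_mulVec_pushVec,
    csGatesL_mulVec_pushVec, gE_mulVec_pushVec, mulVec_mulVec, mulVec_mulVec, mulVec_mulVec,
    hcUnitary_eq_factor, uS_eq_permMat, shiftEquiv_eq_star_mul M (two_le_nw p n), permMat_mul]
  simp only [Matrix.mul_assoc]

end structured


/-! ### Loading the input -/

section load

variable (M : QTM) (p : Polynomial ℕ) (n : ℕ) (x : Fin n → Bool)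

/-- The window after loading the input bits in `S`: cell `i` holds `embed (x i)` for `i ∈ S`, blanks elsewhere. [folklore] -/
def wLoad (S : Finset (Fin n)) (z : ZMod (nw p n)) : M.Γ :=
  if h : z.val < n then (if (⟨z.val, h⟩ : Fin n) ∈ S then M.embed (x ⟨z.val, h⟩) else default) else default

/-- The register after loading the input bits in `S` (start state, rested work bits). [folklore] -/
def rLoad (S : Finset (Fin n)) : M.HC (nw p n) := (M.start, M.wLoad p n x S, false, false)

/-- Input positions are small window positions. [folklore] -/
theorem val_natCast_fin (i : Fin n) : ((i.val : ZMod (nw p n))).val = i.val := by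
  rw [ZMod.val_natCast, Nat.mod_eq_of_lt (i.2.trans (lt_nw p n))]

/-- Cell `i` of the partially loaded window. [folklore] -/
theorem wLoad_self (S : Finset (Fin n)) (i : Fin n) :
    M.wLoad p n x S (i.val : ZMod (nw p n)) = if i ∈ S then M.embed (x i) else default := by
  unfold wLoad
  have h := val_natCast_fin p n i
  have hi : ((i.val : ZMod (nw p n))).val < n := by rw [h]; exact i.2
  rw [dif_pos hi]
  have : (⟨((i.val : ZMod (nw p n))).val, hi⟩ : Fin n) = i := Fin.ext h
  rw [this]

/-- The load gate `i` loads input bit `i` into cell `i` (`u(x, K)`, §4, one bit). [cite: NishimuraOzawa2002, §4] -/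
theorem gLD_mulVec_single (a : Bool) (S : Finset (Fin n)) (i : Fin n) (hi : i ∉ S) :
    (M.gLD p n i).toMatrix 0 *ᵥ Pi.single (M.ι p n x a (M.rLoad p n x S)) 1 =
      Pi.single (M.ι p n x a (M.rLoad p n x (insert i S))) 1 := by
  change placeGate (M.eLD p n i) (extendGate M.κLD (permMat M.loadPerm)) *ᵥ _ = _
  apply placeGate_extendGate_permMat_single (M.eLD p n i) M.κLD_injective M.loadPerm _ _ (x i, default)
  · rw [ι_comp_eLD]
    show M.κLD (x i, M.wLoad p n x S (i.val : ZMod (nw p n))) = _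
    rw [wLoad_self, if_neg hi]
  · rw [ι_comp_eLD, loadPerm_apply]
    show M.κLD (x i, M.wLoad p n x (insert i S) (i.val : ZMod (nw p n))) = _
    rw [wLoad_self, if_pos (Finset.mem_insert_self _ _), Equiv.swap_apply_left]
  · rw [eLD, forall_off_iff]
    intro z hz
    rw [ι_apply_θ, ι_apply_θ]
    rcases idx_cases z with ⟨i', rfl⟩ | rfl | ⟨b, rfl⟩ | rfl | rfl | ⟨j, b, rfl⟩
    · rfl
    · rfl
    · rfl
    · rfl
    · rfl
    · simp only [idxVal_ixCell]
      have hj : j.val ≠ i.val := by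
        intro h
        apply hz
        refine ⟨Sum.inr b, ?_⟩
        simp only [ldWires, Sum.elim_inr, cellAt]
        congr 1
        exact Fin.ext h.symm
      show M.κΓ (M.wLoad p n x (insert i S) (cellOf p n j)) b = M.κΓ (M.wLoad p n x S (cellOf p n j)) b
      unfold wLoad
      rw [val_cellOf]
      by_cases hjn : j.val < n
      · rw [dif_pos hjn, dif_pos hjn]
        have : (⟨j.val, hjn⟩ : Fin n) ≠ i := fun h => hj (by rw [← h])
        simp only [Finset.mem_insert, this, false_or]
      · rw [dif_neg hjn, dif_neg hjn]

/-- A list of distinct load gates loads the corresponding bits. [folklore] -/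
theorem loadList_mulVec_single (a : Bool) (l : List (Fin n)) (hl : l.Nodup) (S : Finset (Fin n))
    (hS : ∀ i ∈ l, i ∉ S) :
    listMat (l.map (M.gLD p n)) *ᵥ Pi.single (M.ι p n x a (M.rLoad p n x S)) 1 =
      Pi.single (M.ι p n x a (M.rLoad p n x (S ∪ l.toFinset))) 1 := by
  induction l generalizing S with
  | nil =>
    rw [List.map_nil, listMat_nil, one_mulVec]
    simp only [List.toFinset_nil, Finset.union_empty]
  | cons i l ih =>
    rw [List.map_cons, listMat_cons, ← mulVec_mulVec, gLD_mulVec_single _ _ _ _ _ _ _ (hS i (by simp)),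
      ih (List.Nodup.of_cons hl) (insert i S)]
    · have : insert i S ∪ l.toFinset = S ∪ (i :: l).toFinset := by
        ext j
        simp only [Finset.mem_union, Finset.mem_insert, List.toFinset_cons, List.mem_toFinset]
        tauto
      rw [this]
    · intro i' hi'
      rw [Finset.mem_insert, not_or]
      refine ⟨?_, hS i' (List.mem_cons_of_mem _ hi')⟩
      rintro rfl
      exact (List.nodup_cons.1 hl).1 hi'

/-- **The load stage writes the encoded input** (`e_t(x)`, §4) into the cells. [cite: NishimuraOzawa2002, §4 (encoding e_t)] -/
theorem loadGates_mulVec_single (a : Bool) :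
    listMat (M.loadGates p n) *ᵥ Pi.single (M.ι p n x a (M.rLoad p n x ∅)) 1 =
      Pi.single (M.ι p n x a (M.rLoad p n x Finset.univ)) 1 := by
  rw [loadGates, loadList_mulVec_single _ _ _ _ _ _ (List.nodup_finRange n) ∅ (fun _ _ => Finset.notMem_empty _)]
  congr 3
  ext j
  simp

/-- The tree's initial state `|x⟩|0…0⟩` is the code of the empty-loaded register (blank and start are coded by zeros). [folklore] -/
theorem padInput_eq_ι : padInput x (M.anc p n) = M.ι p n x false (M.rLoad p n x ∅) := by
  funext w
  obtain ⟨z, rfl⟩ := (M.θ p n).surjective w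
  rw [ι_apply_θ]
  rcases z with i | zz
  · rw [show (Sum.inl i : M.Idx p n) = ixIn i from rfl, θ_ixIn, padInput, Fin.append_left]
    rfl
  · rw [θ_inr, padInput, Fin.append_right]
    rcases zz with ((((aa | b) | d) | e) | ⟨j, b⟩)
    · rfl
    · show false = M.κΛ M.start b
      rw [κΛ_start]
    · rfl
    · rfl
    · show false = M.κΓ (M.wLoad p n x ∅ (cellOf p n j)) b
      have : M.wLoad p n x ∅ (cellOf p n j) = default := by
        unfold wLoad
        split_ifs <;> first | rfl | simp at *
      rw [this, κΓ_default]

/-- The fully loaded window is the window of the input tape `tape[x]` of the machine (`window_mk₁`; `n ≤ N/2`).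
[cite: NishimuraOzawa2002, §4 (encoding e_t)] -/
theorem wLoad_univ_eq_window (xs : List Bool) :
    M.wLoad p xs.length xs.get Finset.univ = window (nw p xs.length) (Tape.mk₁ (xs.map M.embed)) := by
  funext z
  rw [window_mk₁]
  unfold wLoad
  simp only [Finset.mem_univ, if_true]
  have hN : xs.length ≤ nw p xs.length / 2 := by
    unfold nw; omega
  by_cases hz : z.val ≤ nw p xs.length / 2
  · have hv : z.valMinAbs = z.val := by
      conv_lhs => rw [← ZMod.natCast_zmod_val z]
      exact ZMod.valMinAbs_natCast_of_le_half hz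
    rw [hv, if_pos (Int.natCast_nonneg _), Int.toNat_natCast]
    by_cases hlt : z.val < xs.length
    · rw [dif_pos hlt, List.getI_eq_getElem _ (by simpa using hlt), List.getElem_map]
      rfl
    · rw [dif_neg hlt, List.getI_eq_default _ (by simpa using not_lt.1 hlt)]
  · have hv : z.valMinAbs < 0 := by
      rw [← not_le, ZMod.valMinAbs_nonneg_iff]
      exact hz
    rw [if_neg (not_le.2 hv), dif_neg]
    omega

/-- The fully loaded register is the code of the initial configuration `(q₀, tape[x])`. [folklore] -/
theorem rLoad_univ_eq_encCfg (xs : List Bool) :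
    M.rLoad p xs.length xs.get Finset.univ = M.encCfg (nw p xs.length) (M.init xs) := by
  rw [rLoad, wLoad_univ_eq_window]
  rfl

end load

/-! ### Readout -/

section readout

variable (M : QTM) (p : Polynomial ℕ) (n : ℕ) (x : Fin n → Bool)

/-- The readout gate copies `[state = accept]` into the answer wire. [folklore] -/
theorem gAC_mulVec_single (r : M.HC (nw p n)) :
    (M.gAC p n).toMatrix 0 *ᵥ Pi.single (M.ι p n x false r) 1 =
      Pi.single (M.ι p n x (decide (r.1 = M.accept)) r) 1 := by
  change placeGate (M.eAC p n) (extendGate M.κAC (permMat M.accPerm)) *ᵥ _ = _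
  apply placeGate_extendGate_permMat_single (M.eAC p n) M.κAC_injective M.accPerm _ _ (r.1, false)
  · exact M.ι_comp_eAC p n x false r
  · rw [ι_comp_eAC, accPerm_apply, Bool.false_xor]
  · rw [eAC, forall_off_iff]
    intro z hz
    rw [ι_apply_θ, ι_apply_θ]
    rcases idx_cases z with ⟨i', rfl⟩ | rfl | ⟨b, rfl⟩ | rfl | rfl | ⟨j, b, rfl⟩
    · rfl
    · exact absurd ⟨Sum.inr 0, rfl⟩ hz
    · rfl
    · rfl
    · rfl
    · rfl

/-- The `k`-th star transposition of wires: `(wire 0, wire k)` for `k ≤ n`, the identity beyond. [folklore] -/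
def wswap (k : ℕ) : Equiv.Perm (Fin (n + M.anc p n)) :=
  if k ≤ n then Equiv.swap (M.θ p n (M.wireAt p n 0)) (M.θ p n (M.wireAt p n k)) else 1

/-- The composite `(0 1)(0 2)⋯(0 m)` of the final swaps (`(0 m)` applied first). [folklore] -/
def swapChain (m : ℕ) : Equiv.Perm (Fin (n + M.anc p n)) :=
  ((List.range m).map fun k => M.wswap p n (k + 1)).prod

/-- The pins of the `k`-th final swap. [folklore] -/
theorem eSW_apply (k : Fin n) (c : Fin 2) : M.eSW p n k c = M.θ p n (M.swWires p n k c) := rfl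

/-- The final swaps act on basis vectors through `swapChain n`. [folklore] -/
theorem finalSwaps_mulVec_single (l : List (Fin n)) (y : QReg (n + M.anc p n)) :
    listMat (l.map (M.gSW p n)) *ᵥ Pi.single y 1 =
      Pi.single (y ∘ ⇑((l.map fun k => M.wswap p n (k.val + 1)).prod)) 1 := by
  induction l generalizing y with
  | nil =>
    rw [List.map_nil, listMat_nil, one_mulVec]
    simp only [List.map_nil, List.prod_nil, Equiv.Perm.coe_one, Function.comp_id]
  | cons k l ih =>
    rw [List.map_cons, listMat_cons, ← mulVec_mulVec]
    change listMat _ *ᵥ (placeGate (M.eSW p n k) (permMat swapPerm) *ᵥ _) = _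
    rw [placeGate_swapPerm_single, ih, List.map_cons, List.prod_cons, Equiv.Perm.coe_mul,
      ← Function.comp_assoc]
    congr 2
    rw [eSW_apply, eSW_apply, wswap, if_pos (by omega)]
    rfl

/-- The final bit pattern of a register state: readout done and the answer brought to wire `0` by the star swaps.
[folklore] -/
def finMap (r : M.HC (nw p n)) : QReg (n + M.anc p n) :=
  M.ι p n x (decide (r.1 = M.accept)) r ∘ ⇑(M.swapChain p n n)

/-- The final stage sends the code of `r` to its final bit pattern. [folklore] -/
theorem finalGates_mulVec_single (r : M.HC (nw p n)) :
    listMat (M.finalGates p n) *ᵥ Pi.single (M.ι p n x false r) 1 = Pi.single (M.finMap p n x r) 1 := by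
  rw [finalGates, listMat_append, listMat_singleton, ← mulVec_mulVec, gAC_mulVec_single,
    finalSwaps_mulVec_single, finMap, swapChain, ← List.map_coe_finRange_eq_range, List.map_map]
  rfl

/-- The code is injective jointly in the answer bit and the register. [folklore] -/
theorem ι_inj' {a a' : Bool} {r r' : M.HC (nw p n)} (h : M.ι p n x a r = M.ι p n x a' r') : r = r' := by
  have hz : ∀ z, M.idxVal p n x a r z = M.idxVal p n x a' r' z := fun z => by
    have := congrFun h (M.θ p n z)
    simpa using this
  obtain ⟨q, w, d, e⟩ := r
  obtain ⟨q', w', d', e'⟩ := r'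
  have hq : q = q' := M.κΛ_injective (funext fun b => hz (ixSt b))
  have hd : d = d' := hz ixD
  have he : e = e' := hz ixE
  have hw : w = w' := by
    funext i
    obtain ⟨j, rfl⟩ := cellOf_surjective p n i
    exact M.κΓ_injective (funext fun b => hz (ixCell j b))
  rw [hq, hd, he, hw]

/-- Final bit patterns of distinct register states are distinct. [folklore] -/
theorem finMap_injective : Function.Injective (M.finMap p n x) := by
  intro r r' h
  apply M.ι_inj' p n x (a := decide (r.1 = M.accept)) (a' := decide (r'.1 = M.accept))
  funext w
  have := congrFun h ((M.swapChain p n n).symm w)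
  simpa [finMap] using this

/-- The star chain brings wire `m` to wire `0`: `(0 1)(0 2)⋯(0 m)` sends `0 ↦ m` and fixes the wires beyond `m`.
[folklore] -/
theorem swapChain_spec (m : ℕ) (hm : m ≤ n) :
    (1 ≤ m → M.swapChain p n m (M.θ p n (M.wireAt p n 0)) = M.θ p n (M.wireAt p n m)) ∧
      ∀ j, m < j → j ≤ n → M.swapChain p n m (M.θ p n (M.wireAt p n j)) = M.θ p n (M.wireAt p n j) := by
  have hwne : ∀ {k k' : ℕ}, k ≤ n → k' ≤ n → k ≠ k' →
      M.θ p n (M.wireAt p n k) ≠ M.θ p n (M.wireAt p n k') :=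
    fun hk hk' hne h => hne (M.wireAt_injective p n hk hk' ((M.θ p n).injective h))
  induction m with
  | zero =>
    refine ⟨fun h => absurd h (by omega), fun j _ _ => ?_⟩
    simp [swapChain]
  | succ m ih =>
    obtain ⟨ih1, ih2⟩ := ih (by omega)
    have hsc : M.swapChain p n (m + 1) = M.swapChain p n m * M.wswap p n (m + 1) := by
      rw [swapChain, List.range_succ, List.map_append, List.prod_append, List.map_singleton,
        List.prod_singleton, swapChain]
    refine ⟨fun _ => ?_, fun j hj hjn => ?_⟩
    · rw [hsc, Equiv.Perm.mul_apply, wswap, if_pos hm, Equiv.swap_apply_left]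
      exact ih2 (m + 1) (by omega) hm
    · rw [hsc, Equiv.Perm.mul_apply, wswap, if_pos hm,
        Equiv.swap_apply_of_ne_of_ne (hwne hjn (by omega) (by omega)) (hwne hjn hm (by omega))]
      exact ih2 j (by omega) hjn

end readout


/-! ### The circuit family simulates the machine -/

section main

variable (M : QTM) (p : Polynomial ℕ)

/-- There is at least one ancilla (so wire `0` exists). [folklore] -/
theorem anc_pos (n : ℕ) : 0 < M.anc p n := by unfold anc; omega

/-- **Wire `0` of the final pattern reads `[state = accept]`.** [folklore] -/
theorem finMap_zero (n : ℕ) (x : Fin n → Bool) (hW : 0 < n + M.anc p n) (r : M.HC (nw p n)) :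
    M.finMap p n x r ⟨0, hW⟩ = decide (r.1 = M.accept) := by
  have h0 : (⟨0, hW⟩ : Fin (n + M.anc p n)) = M.θ p n (M.wireAt p n 0) :=
    Fin.ext (by rw [θ_wireAt_val]; exact Nat.zero_le _)
  have hn : M.wireAt p n n = ixAns := by unfold wireAt; rw [dif_neg (lt_irrefl n)]
  rw [finMap, Function.comp_apply, h0]
  rcases Nat.eq_zero_or_pos n with hz | hpos
  · subst hz
    rw [show M.swapChain p 0 0 = 1 by simp [swapChain], Equiv.Perm.one_apply, hn, ι_apply_θ, idxVal_ixAns]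
  · rw [(M.swapChain_spec p n n le_rfl).1 hpos, hn, ι_apply_θ, idxVal_ixAns]

/-- **The simulating circuit on `|x⟩|0…0⟩`**: the output state is the re-coded `hcUnitary^{p(n)} |code of (q₀, tape[x])⟩`
— load, then `p(n)` exact steps (`stepGates_mulVec_pushVec`), then readout. [cite: NishimuraOzawa2002, Thm. 4.3] -/
theorem hcCirc_toMatrix_mulVec (n : ℕ) (x : Fin n → Bool) :
    (M.hcCirc p n).toMatrix 0 *ᵥ Pi.single (padInput x (M.anc p n)) 1 =
      pushVec (M.finMap p n x)
        ((M.hcUnitary (nw p n)) ^ (tm p n) *ᵥ Pi.single (M.rLoad p n x Finset.univ) 1) := by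
  rw [toMatrix_eq_listMat, hcCirc, circGates, listMat_append, listMat_append, ← mulVec_mulVec,
    ← mulVec_mulVec, padInput_eq_ι, loadGates_mulVec_single, ← pushVec_single (ι_injective x false),
    listMat_flatten_replicate, pow_mulVec_pushVec (M.stepGates_mulVec_pushVec p n x) (tm p n),
    mulVec_pushVec_of_single (M.finalGates_mulVec_single p n x)]

/-- **The circuit family `hcFamily M p` simulates the quantum Turing machine `M` exactly**: for every
machine well formed in the tree's sense, every polynomial `p` and every input `x`,
`(hcFamily M p).acceptProbOn 0 x = QTM.acceptProbAt M x (p |x|)` — the acceptance probability of the tree's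
`BQPQTMWith`/`BQPQTM` (control state observed at time `p(|x|)`, head-relative quotient semantics) IS the acceptance
probability (wire `0`) of a uniform-shaped, oracle-free circuit family over the finite gate set `𝒢_M`. This is
Nishimura–Ozawa 2002, Thm. 4.3 (after Yao 1993) — "there is a quantum circuit … that `t`-simulates `M`", with
`ε = 0` — for the tree's model, the measured observable being the control state; combined with
`QTM.acceptProbAt_eq_hcUnitary`, `hcGateSet_isUnitary`, `hcGateSet_isInverseClosed`, `hcGateSet_polyTime` it reduces
`BQPQTM ⊆ BQP` (S04 of `QuantumComplexity/QuantumTuring.lean`) to the uniformity of `hcFamily` and gate-set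
independence `BQPOver_eq_BQP`. [cite: NishimuraOzawa2002, Thm. 4.3] -/
theorem acceptProbOn_hcFamily (hwf : M.IsWellFormed) (xs : List Bool) :
    (M.hcFamily p).acceptProbOn 0 xs = M.acceptProbAt xs (tm p xs.length) := by
  have hW : 0 < xs.length + M.anc p xs.length := Nat.add_pos_right _ (M.anc_pos p _)
  unfold QCircuitFamily.acceptProbOn
  change (M.hcCirc p xs.length).acceptProb 0 xs.get = _
  unfold QCircuit.acceptProb
  simp only [dif_pos hW]
  unfold QCircuit.runOn basisState
  rw [hcCirc_toMatrix_mulVec, rLoad_univ_eq_encCfg,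
    M.acceptProbAt_eq_hcUnitary (nw p xs.length) hwf xs (tm p xs.length) (by unfold nw tm; exact le_refl _),
    sum_pushVec (M.finMap_injective p _ xs.get) _ (fun y c => if y ⟨0, hW⟩ = true then ‖c‖ ^ 2 else 0)
      (fun y => by simp)]
  refine Finset.sum_congr rfl fun r _ => ?_
  rw [finMap_zero]
  by_cases h : r.1 = M.accept <;> simp [h]

end main

end QTM

end Literature.Computability.Cryptography

end
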